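import Summits.BirchSwinnertonDyer.BirchSwinnertonDyer.Theorems.ClassRecordThreeCornerAtThreeKolyImageCebotarevShift
import Summits.BirchSwinnertonDyer.BirchSwinnertonDyer.Theorems.ClassRecordThreeShimuraKolyvaginCebotarevKernelOfImage
import Summits.BirchSwinnertonDyer.BirchSwinnertonDyer.Theorems.ErratumRoadFiveShimuraKolyvaginOrderBoundInertShiftCebotarev
import Summits.BirchSwinnertonDyer.BirchSwinnertonDyer.Theorems.ClassRecordThreeShimuraKolyvaginOrderBoundAtThreeSurjDeepLevel
import Literature.NumberTheory.EllipticCurves.HeegnerPointsKolyvaginPrimaryOrderCebProofs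
import HarnessLib

/-!
# The IMAGE-KEYED Kolyvagin ORDER machine, I6: McCallum's Prop. 3.1 in KERNEL form one level deeper (Kolyvagin primes with
# `Frob(ℓ) = Frob(∞)` on `E[p^{M+k}]`, prescribed kernel of localisation on `⟨g₁, g₂, T⟩ ≤ H¹(K, E[p^M])`) = the `hCeb` input of
# the ORDER machine at depth `M + k`, from the four image inputs instead of `ρ̄_{E,p}` onto
# (crux `CornerAtThree`, item stmt-BirchSwinnertonDyer-19111, conjunct 3 along the CARRIER-INERT Shimura road;
# cell `bsd-stepL`, seat `bsd-stepL-corner3-p2` g5 = WIDTH-LEVER lane B; `--supports … --as helper`)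

HONEST FRAMING: THEOREMS ONLY (no definition, no named fact, no `sorry`); nothing here is a BSD class theorem;
no census label moves (T7); item 19111 is NOT closed; every statement is CONDITIONAL on its displayed binders
exactly as its `hρ`-keyed original. BSD is not proved by any of this.

## The series (why this file exists)

Lane B's typed object `Theorems.CornerAtThreeShimuraInertDisplay` (conjunct 1 of the registered stub
`stub_upper3_inertDisplay` of `Cruxes/CornerAtThree/Lines/inert.lean`, planner RULING 35) is Kolyvagin's UNSHARP
order bound `#Ш(E/K)[3^∞] ≤ 3^(2·ord₃[E(K):ℤP])` for the CM point of `X_{N⁺,N⁻}` with `3 ∣ N⁻` on the (T4″)₃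
corner (`E[3]` irreducible, `ρ̄_{E,3}` NOT onto). The tree's Shimura–Kolyvagin ORDER chain
(`ErratumRoadFiveShimuraKolyvaginOrderBoundInert*`, `ClassRecordThreeShimuraKolyvaginOrderBoundAtThreeSurjOrderShift*`;
seats shim-p1 ∕ shim3a) is keyed on `hρ : ρ̄_{E,p}` ONTO, read ONLY through four consequences (seat shim3b g4 ∕ g5,
memo `shim/SHIM3B-G5-NOTE-19616.md` §2 «execute only if a consumer appears» — the consumer is lane B's inert line):
(hIz) some `z ∈ Γ_K` acts as `−1` on `E(K̄)[p]`, (hIs) `E(K̄)[p]` is a simple `Γ_K`-module, (hIc) its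
`Γ_K`-commutant is scalar, (hIt) `E(K)[p] = 0`. The series `ClassRecordThreeCornerAtThreeKolyImage*.lean`
(namespace `…Theorems.ShimuraKolyvaginOfImage`; theorem names = originals + `_ofImage`) re-keys the chain on these
four binders: statements and proofs are the originals VERBATIM with `hρ` replaced by `(hIz) (hIs) (hIc) (hIt)` and
the image-reading leaves replaced by shim3b's landed twins (`ShimuraKolyvaginCebotarevOfImage.McCallum1991_cor_3_2_pow_of_image`,
`ShimuraKolyvaginCebotarevKernelOfImage.exists_kolyvaginPrime_gt_pow_kernel_of_image`,
`ShimuraKolyvaginFixedOfTorsion.{geomTorsion_pow_eq_zero_of_fixed, torsionH1OfDvd_pow_injective}_of_torsionBy_eq_bot`,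
`KolyvaginDescent.*_of_torsionBy_eq_bot`). At `p = 3` the four inputs hold for EVERY irreducible `E[3]`
(`ShimuraKolyvaginOfImage.kolyvaginImageInputs_three_of_mem_inertSet`, p563651), so the re-keyed END serves the
corner; at `p ∈ {5, 7}` they hold on the non-surjective corners given `−1 ∈ ρ̄(Γ_ℚ)` (shim3b
`McCallum1991_cor_3_2_pow_of_irr_of_neg`). No new mathematics is claimed in the re-keyed files.

## THIS FILE re-keys shim3a g2's `…AtThreeSurjOrderCebShift` (p484973): `exists_kolyvaginPrime_gt_pow_kernel_shift_ofImage` (leaf =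
shim3b's `ShimuraKolyvaginCebotarevKernelOfImage.exists_kolyvaginPrime_gt_pow_kernel_of_image`), `ceb_kernel_of_dictionary_level_shift_ofImage`.
Statements ∕ proofs VERBATIM the originals except `hρ` ↦ `(hIz) (hIs) (hIc) (hIt)`, the image-reading leaves ↦
shim3b's `_of_image` ∕ `_of_torsionBy_eq_bot` twins, and calls into earlier `_ofImage` twins of this series.
[cite: McCallumLMS1991, §1 Theorem (Kolyvagin), §3 Prop. 3.1, Cor. 3.2, §4 Lemma 4.3, Prop. 4.4, Lemma 4.6, Prop. 4.7, §5 Lemmas 5.1, 5.3, Thm. 5.4, Cor. 5.6]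
[cite: GrossLMS1991, Props. 5.3, 5.4, 8.2, §9, §10] [cite: Howard2004Duke, Thm. 3.2.2 (proof)] [cite: MilneADT2006, Ch. I Thm. 4.10(b), §6 Thm. 6.13(a)]
presearch: as I2 (cell D8 audit; shim3b g5 §1: nothing in print at an inert p = 3 for non-surjective image).
-/

noncomputable section

open scoped Classical Pointwise
set_option linter.dupNamespace false

universe u

namespace Summit.BirchSwinnertonDyer.BirchSwinnertonDyer.Theorems.ShimuraKolyvaginOfImage

open WeierstrassCurve NumberField IsDedekindDomain Field
  Literature.NumberTheory.EllipticCurves Literature.NumberTheory.EllipticCurves.KolyvaginDescent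
  Literature.NumberTheory.GaloisRepresentations
  Summit.BirchSwinnertonDyer.Rank1Residual
  Summit.BirchSwinnertonDyer.BirchSwinnertonDyer.Theorems
  Summit.BirchSwinnertonDyer.BirchSwinnertonDyer.Theorems.ShimuraKolyvaginLocalShift

variable (W : WeierstrassCurve ℚ) {K : Type} [Field K] [NumberField K]

/-- **McCallum 1991, Prop. 3.1 (kernel form) — one Kolyvagin prime of DEPTH `p^{M+k}` above any bound with
prescribed kernel of localisation on `⟨g₁, g₂, T⟩ ≤ H¹(K, E[p^M])`.** Hypotheses as in x11b3's
`exists_kolyvaginPrime_gt_pow_kernel` (at level `M`) plus the extra depth `k`; conclusion: `ℓ > b` with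
`IsKolyvaginPrime N W K p ℓ`, `Frob(ℓ) = Frob(∞)` on `K(E[p^{M+k}])`, and `g ∈ ker(loc_λ) ⟺ g ∈ ⟨T⟩` for every
`g ∈ ⟨g₁, g₂, T⟩` at the place `λ ∋ ℓ`. Proof: the level-`(M+k)` theorem for `ι_* g₁, ι_* g₂, ι_* T`, transferred
back along the injective, `Aut(K/ℚ)`-equivariant change of level `ι_*` (shim-p1's `torsionH1OfDvd_pow_injective`,
`conjAct_torsionH1OfDvd`, `mem_torsionLocalKer_iff_torsionH1OfDvd_mem`). [cite: McCallumLMS1991, §3 Prop. 3.1 with (2), (3)]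
[cite: GrossLMS1991, §3 (3.1)–(3.3)] -/
theorem exists_kolyvaginPrime_gt_pow_kernel_shift_ofImage
    (hC : Literature.NumberTheory.Automorphic.chebotarev_artinRep) {N : ℕ} [NeZero N] [W.IsElliptic]
    (hK : IsImaginaryQuadratic K) {p : ℕ} (hp : p.Prime) (hp2 : p ≠ 2)
    (hIz : ∃ z : Field.absoluteGaloisGroup K, ∀ t : geomTorsion (W.baseChange K) p, z • t = -t)
    (hIs : (W.baseChange K).HasIrreducibleModPGaloisRep p)
    (hIc : ∀ f : geomTorsion (W.baseChange K) p →+ geomTorsion (W.baseChange K) p,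
      (∀ (g : Field.absoluteGaloisGroup K) (t : geomTorsion (W.baseChange K) p), f (g • t) = g • f t) →
        ∃ k : ℤ, ∀ t, f t = k • t)
    (hIt : AddSubgroup.torsionBy (W.baseChange K).toAffine.Point (p : ℤ) = ⊥) (hW : W.exists_weilPairing p) {M : ℕ} (hM : 1 ≤ M) (k : ℕ)
    {c : K ≃ₐ[ℚ] K} (hc : c ≠ 1) (hcc : c * c = 1)
    (Tc : Finset (galH1Torsion (W.baseChange K) ((p ^ M : ℕ) : ℤ)))
    (g₁ g₂ : galH1Torsion (W.baseChange K) ((p ^ M : ℕ) : ℤ)) {ν : ℤ} (hν : ν = 1 ∨ ν = -1)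
    (hg₁ : conjAct W c ((p ^ M : ℕ) : ℤ) g₁ = ν • g₁)
    (hg₂ : conjAct W c ((p ^ M : ℕ) : ℤ) g₂ = (-ν) • g₂)
    (hTc : ∀ t ∈ Tc, ∃ e : ℤ, (e = 1 ∨ e = -1) ∧ conjAct W c ((p ^ M : ℕ) : ℤ) t = e • t)
    (b : ℕ) :
    ∃ ℓ : ℕ, b < ℓ ∧ IsKolyvaginPrime N W K p ℓ ∧ FrobEqFrobInfty W K (p ^ (M + k)) ℓ ∧
      ∀ g ∈ AddSubgroup.closure (insert g₁ (insert g₂ (Tc : Set _))),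
        ∀ v : HeightOneSpectrum (𝓞 K), (ℓ : 𝓞 K) ∈ v.asIdeal →
          (g ∈ (W.baseChange K).torsionLocalKer (v.adicCompletion K) ((p ^ M : ℕ) : ℤ) ↔
            g ∈ AddSubgroup.closure (Tc : Set _)) := by
  classical
  haveI : (W.baseChange K).IsElliptic := inferInstanceAs (W.map (algebraMap ℚ K)).IsElliptic
  have hdvd := natCast_pow_dvd_natCast_pow_add p M k
  set ι := torsionH1OfDvd (W.baseChange K) hdvd with hιdef
  have hιinj : Function.Injective ι := ShimuraKolyvaginFixedOfTorsion.torsionH1OfDvd_pow_injective_of_torsionBy_eq_bot W hIt M k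
  -- ### the shifted classes `ι_* g₁, ι_* g₂, ι_* T ∈ H¹(K, E[p^{M+k}])`
  have hg₁' : conjAct W c ((p ^ (M + k) : ℕ) : ℤ) (ι g₁) = ν • ι g₁ := by
    rw [hιdef, conjAct_torsionH1OfDvd, hg₁, map_zsmul]
  have hg₂' : conjAct W c ((p ^ (M + k) : ℕ) : ℤ) (ι g₂) = (-ν) • ι g₂ := by
    rw [hιdef, conjAct_torsionH1OfDvd, hg₂, map_zsmul]
  have hTc' : ∀ t ∈ Tc.image ι, ∃ e : ℤ, (e = 1 ∨ e = -1) ∧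
      conjAct W c ((p ^ (M + k) : ℕ) : ℤ) t = e • t := by
    intro t ht
    obtain ⟨s, hs, rfl⟩ := Finset.mem_image.mp ht
    obtain ⟨e, he, hes⟩ := hTc s hs
    exact ⟨e, he, by rw [hιdef, conjAct_torsionH1OfDvd, hes, map_zsmul]⟩
  -- ### the bound: above `b` and above the rational primes under the bad places of `E/K`
  have hbad : ((W.baseChange K).badPlaces (𝓞 K)).Finite := (W.baseChange K).finite_badPlaces_holds (𝓞 K)
  set B : ℕ := hbad.toFinset.sup fun w ↦ (Rat.HeightOneSpectrum.primesEquiv (w.under (𝓞 ℚ)) : ℕ)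
    with hB
  have hM' : 1 ≤ M + k := le_trans hM (Nat.le_add_right M k)
  obtain ⟨ℓ, hbℓ, hℓP, hℓN, hℓD, hℓp, hprime, hfrob, hloc⟩ :=
    ShimuraKolyvaginCebotarevKernelOfImage.exists_kolyvaginPrime_gt_pow_kernel_of_image (N := N) hC hK hp hp2
      hIz hIs hIc hW hM' hc hcc (Tc.image ι) (ι g₁) (ι g₂)
      hν hg₁' hg₂' hTc' (max b B)
  have hb : b < ℓ := lt_of_le_of_lt (le_max_left b B) hbℓ
  have hBℓ : B < ℓ := lt_of_le_of_lt (le_max_right b B) hbℓ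
  -- the depth-`p` Frobenius clause of `IsKolyvaginPrime` from depth `p^{M+k}`
  have hKol : IsKolyvaginPrime N W K p ℓ :=
    ⟨hℓP, hℓN, hℓD, hℓp, hprime,
      frobEqFrobInfty_of_dvd W K (dvd_pow_self p (by omega : M + k ≠ 0)) hfrob⟩
  -- ### good reduction at `λ`
  have hgood : hKol.place ∉ (W.baseChange K).badPlaces (𝓞 K) := by
    intro hmem
    have hle : (Rat.HeightOneSpectrum.primesEquiv (hKol.place.under (𝓞 ℚ)) : ℕ) ≤ B :=
      Finset.le_sup (f := fun w : HeightOneSpectrum (𝓞 K) ↦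
        (Rat.HeightOneSpectrum.primesEquiv (w.under (𝓞 ℚ)) : ℕ)) (hbad.mem_toFinset.mpr hmem)
    have hℓeq : (Rat.HeightOneSpectrum.primesEquiv (hKol.place.under (𝓞 ℚ)) : ℕ) = ℓ := by
      rw [(natCast_mem_asIdeal_iff_eq_primesEquiv_symm _ hKol.prime).mp hKol.natCast_mem_under,
        Equiv.apply_symm_apply]
    omega
  -- ### `Γ_{K_λ}` fixes `E[p^{M+k}]`
  haveI : NeZero (p ^ (M + k)) := ⟨pow_ne_zero _ hp.ne_zero⟩
  have hpv : ((p : ℕ) : 𝓞 K) ∉ hKol.place.asIdeal :=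
    not_natCast_mem_of_prime_ne hKol.prime hp hKol.2.2.2.1 hKol.place hKol.mem_place
  have hqv : ((((p ^ (M + k) : ℕ) : ℤ)) : 𝓞 K) ∉ hKol.place.asIdeal := by
    rw [Int.cast_natCast, Nat.cast_pow]
    exact fun h ↦ hpv (hKol.place.isPrime.mem_of_pow_mem (M + k) h)
  have htriv : ∀ (g : absoluteGaloisGroup (hKol.place.adicCompletion K))
      (Q : geomTorsion (W.baseChange K) ((p ^ (M + k) : ℕ) : ℤ)),
      resGal (K := K) (hKol.place.adicCompletion K) g • Q = Q := fun g Q ↦ by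
    rw [resGal_eq_absGaloisRestrict]
    exact absGaloisRestrict_smul_geomTorsion_eq_of_kolyvaginPrime W hK hKol hfrob hgood hqv g Q
  -- ### assemble: transfer the kernel statement back along `ι_*`
  refine ⟨ℓ, hb, hKol, hfrob, fun g hg v hv ↦ ?_⟩
  rw [hKol.mem_iff.mp hv]
  have himg : ι g ∈ AddSubgroup.closure
      (insert (ι g₁) (insert (ι g₂) ((Tc.image ι : Finset _) : Set _))) := by
    have h := AddSubgroup.mem_map_of_mem ι hg
    rw [AddMonoidHom.map_closure, Set.image_insert_eq, Set.image_insert_eq, ← Finset.coe_image] at h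
    exact h
  have key := hloc (ι g) himg hKol.place hKol.mem_place
  have hpd : p ^ M ∣ p ^ (M + k) := pow_dvd_pow p (Nat.le_add_right M k)
  have hpM : p ^ M ≠ 0 := pow_ne_zero M hp.ne_zero
  have hpMk : p ^ (M + k) ≠ 0 := pow_ne_zero _ hp.ne_zero
  have e1 := mem_torsionLocalKer_iff_torsionH1OfDvd_mem (W.baseChange K) (hKol.place.adicCompletion K)
    hpd hpM hpMk htriv g
  have hcl : AddSubgroup.closure ((Tc.image ι : Finset _) : Set _) =
      (AddSubgroup.closure (Tc : Set _)).map ι := by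
    rw [Finset.coe_image, AddMonoidHom.map_closure]
  have e2 : ι g ∈ AddSubgroup.closure ((Tc.image ι : Finset _) : Set _) ↔
      g ∈ AddSubgroup.closure (Tc : Set _) := by
    rw [hcl]
    exact AddSubgroup.mem_map_iff_mem hιinj
  exact e1.trans (key.trans e2)

/-- **`hCeb` for descent data run at DEPTH `M + k`** — twin of x11b3's `HypothesesM.ceb_kernel_of_dictionary_level`
for data `S : HypothesesM (H¹(K, E[n])) Pl`, `n = p^M`, whose involution is `c_*`, whose Kolyvagin primes CONTAIN the
depth-`(M+k)` Kolyvagin primes (`IsKolyvaginPrime N W K p ℓ ∧ FrobEqFrobInfty W K (p^(M+k)) ℓ`), and whose strict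
local conditions `A ℓ` at those primes are "`c_v = 0` at every `v ∋ ℓ`": for eigenclasses `g₁ ∈ V^{ν}`,
`g₂ ∈ V^{-ν}` and a finite set `T` of eigenclasses there is, above every bound, a Kolyvagin prime `ℓ` of `S` with
`⟨g₁, g₂, T⟩ ∩ A ℓ = ⟨T⟩`. [cite: McCallumLMS1991, §3 Prop. 3.1 with (2), (3)] -/
theorem ceb_kernel_of_dictionary_level_shift_ofImage {Pl : Type*} {N : ℕ} [NeZero N] [W.IsElliptic] {p M n : ℕ}
    (hn : n = p ^ M) (k : ℕ)
    (S : HypothesesM (galH1Torsion (W.baseChange K) (n : ℤ)) Pl)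
    (hC : Literature.NumberTheory.Automorphic.chebotarev_artinRep) (hK : IsImaginaryQuadratic K) (hp : p.Prime)
    (hp2 : p ≠ 2) (hIz : ∃ z : Field.absoluteGaloisGroup K, ∀ t : geomTorsion (W.baseChange K) p, z • t = -t)
    (hIs : (W.baseChange K).HasIrreducibleModPGaloisRep p)
    (hIc : ∀ f : geomTorsion (W.baseChange K) p →+ geomTorsion (W.baseChange K) p,
      (∀ (g : Field.absoluteGaloisGroup K) (t : geomTorsion (W.baseChange K) p), f (g • t) = g • f t) →
        ∃ k : ℤ, ∀ t, f t = k • t)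
    (hIt : AddSubgroup.torsionBy (W.baseChange K).toAffine.Point (p : ℤ) = ⊥) (hW : W.exists_weilPairing p)
    (hM : 1 ≤ M) {c : K ≃ₐ[ℚ] K} (hc : c ≠ 1) (hcc : c * c = 1)
    (hτ : ∀ g, S.τ g = conjAct W c (n : ℤ) g)
    (hKol : ∀ ℓ, IsKolyvaginPrime N W K p ℓ → FrobEqFrobInfty W K (p ^ (M + k)) ℓ → S.Kol ℓ)
    (hA : ∀ ℓ, IsKolyvaginPrime N W K p ℓ → ∀ g, g ∈ S.A ℓ ↔
      ∀ v : HeightOneSpectrum (𝓞 K), (ℓ : 𝓞 K) ∈ v.asIdeal →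
        g ∈ (W.baseChange K).torsionLocalKer (v.adicCompletion K) (n : ℤ))
    (T : Finset (galH1Torsion (W.baseChange K) (n : ℤ)))
    (g₁ g₂ : galH1Torsion (W.baseChange K) (n : ℤ)) (ν : ℤ) (hν : ν = 1 ∨ ν = -1)
    (hg₁ : S.τ g₁ = ν • g₁) (hg₂ : S.τ g₂ = (-ν) • g₂)
    (hT : ∀ t ∈ T, ∃ e : ℤ, (e = 1 ∨ e = -1) ∧ S.τ t = e • t) (b : ℕ) :
    ∃ ℓ, b < ℓ ∧ S.Kol ℓ ∧ ∀ g ∈ AddSubgroup.closure (insert g₁ (insert g₂ (T : Set _))),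
      g ∈ S.A ℓ ↔ g ∈ AddSubgroup.closure (T : Set _) := by
  subst hn
  rw [hτ] at hg₁ hg₂
  have hT' : ∀ t ∈ T, ∃ e : ℤ, (e = 1 ∨ e = -1) ∧ conjAct W c ((p ^ M : ℕ) : ℤ) t = e • t :=
    fun t ht ↦ by obtain ⟨e, he, h⟩ := hT t ht; exact ⟨e, he, hτ t ▸ h⟩
  obtain ⟨ℓ, hbℓ, hKP, hfrob, hloc⟩ := exists_kolyvaginPrime_gt_pow_kernel_shift_ofImage W (N := N) hC hK hp hp2 hIz hIs hIc hIt
    hW hM k hc hcc T g₁ g₂ hν hg₁ hg₂ hT' b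
  refine ⟨ℓ, hbℓ, hKol ℓ hKP hfrob, fun g hg ↦ ?_⟩
  rw [hA ℓ hKP g]
  constructor
  · intro h
    exact (hloc g hg hKP.place hKP.mem_place).mp (h hKP.place hKP.mem_place)
  · intro h v hv
    exact (hloc g hg v hv).mpr h

end Summit.BirchSwinnertonDyer.BirchSwinnertonDyer.Theorems.ShimuraKolyvaginOfImage

end
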